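import Summits.CriticalPhenomena.PercolationContinuityZ3.Theorems.PercNearOneGluingNoHeavyLowerTailSahiE3CovHit
import Literature.Probability.LatticeModels.SahiThirdOrderCorrelation
import Mathlib.Tactic.Linarith
import Mathlib.Tactic.Ring
import Mathlib.Tactic.Positivity
import HarnessLib
import HarnessLib.Audit

/-!
# `NoHeavyLowerTail` (crux stmt-CriticalPhenomena-4575), Sahi programme P4 (Holley / monotone coupling):
# flow certificates on a pattern — the TRACE REDUCTION of the pair condition

Support file (cell `prim-l12`, seat P4, generation 8; `--supports stmt-CriticalPhenomena-4575`).  No named facts, no sorries; standard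
axioms; def-free.

`…SahiE3PatternCertificate.phi_nonneg_of_patternCertificate` asks, for a flow certificate `(R, F)` on a pattern `P` with slot-set `U`, the PAIR
inequality for ALL pairs of up-sets `S, S'` of `P`:
  `Z·(N(S)·N_U(S') + N(S')·N_U(S)) − N_U·N(S)·N(S') ≤ Σ_{t∈S∩S'∩U} R t + Σ_{s∈S∩S'∖U} (Σ_t F t s − Z·N_U·ν s)`.
This file proves (for a pattern that is a finite distributive lattice, `ν ≥ 0` log-supermodular — the pattern measure always is — `U` an up-set,
and a certificate with EXACT deliveries `Σ_t F t s = Z·N_U·ν s`, which is forced anyway) that it suffices to check PAIR on pairs of `U`-SATURATED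
up-sets: `S` is `U`-saturated when every `s ∉ U` all of whose `U`-successors lie in `S` already lies in `S` (`pair_of_saturated`).  Reason: the right-hand
side only sees the trace `S ∩ S' ∩ U`; the left-hand side is nondecreasing in the mass of `S ∖ U` because `N_U·ν(T∖U) ≤ N_{P∖U}·ν(T∩U)` for every
up-set `T` (`mass_U_mul_trace_compl_le`, one application of the four functions theorem [Ahlswede–Daykin]); and every up-set is contained in a `U`-saturated
up-set with the same trace (`S ∪ {s ∉ U | ↑s ∩ U ⊆ S}`).  For a pattern with few traces (e.g. `maj` on `2³`: traces `∅, {⊤}, {ij,⊤}, {ij,ik,⊤}, U`) this leaves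
a handful of explicit inequalities (HOME prim-l12-p4/FROM-prim-l12-p4-gen8-PATTERN-CERTIFICATES.md §4b).
-/

namespace Summit.CriticalPhenomena.PercolationContinuityZ3.Theorems.SahiE3PatternReduction

open Finset Literature.Probability.LatticeModels
open scoped BigOperators

variable {P : Type*} [DistribLattice P] [Fintype P] [DecidableEq P]

/-- **The Ahlswede–Daykin one-liner behind the reduction**: for up-sets `U, T` and a nonnegative log-supermodular weight,
`ν(U)·ν(T ∖ U) ≤ ν(P ∖ U)·ν(T ∩ U)`. [this work] -/
theorem mass_U_mul_trace_compl_le {ν : P → ℝ} (hν₀ : 0 ≤ ν) (hν : ∀ a b, ν a * ν b ≤ ν (a ⊓ b) * ν (a ⊔ b))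
    {U T : Finset P} (hU : IsUpperSet (U : Set P)) (hT : IsUpperSet (T : Set P)) :
    (∑ t ∈ U, ν t) * (∑ s ∈ T ∩ Uᶜ, ν s) ≤ (∑ s ∈ Uᶜ, ν s) * (∑ t ∈ T ∩ U, ν t) := by
  have h := SahiE3CovHit.mass_mul_mass_le' (S := U) (T := T ∩ Uᶜ) (V := Uᶜ) (W := T ∩ U) hν₀ hν (fun x hx y hy => by
    rw [Finset.mem_inter, Finset.mem_compl] at hy
    refine ⟨?_, ?_⟩
    · rw [Finset.mem_compl]
      intro hxy
      exact hy.2 (hU (show x ⊓ y ≤ y from inf_le_right) hxy)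
    · rw [Finset.mem_inter]
      exact ⟨hT (show y ≤ x ⊔ y from le_sup_right) hy.1, hU (show x ≤ x ⊔ y from le_sup_left) hx⟩)
  unfold mass at h
  exact h

variable [DecidableLE P]

/-- The `U`-saturation `S ∪ {s ∉ U | every t ∈ U above s lies in S}` of an up-set is an up-set. [this work] -/
theorem isUpperSet_satur {U S : Finset P} (hS : IsUpperSet (S : Set P)) :
    IsUpperSet ((S ∪ Uᶜ.filter fun s => ∀ t ∈ U, s ≤ t → t ∈ S : Finset P) : Set P) := by
  intro x y hxy hx
  rw [Finset.mem_coe, Finset.mem_union] at hx ⊢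
  rcases hx with hx | hx
  · exact Or.inl (hS hxy hx)
  · rw [Finset.mem_filter, Finset.mem_compl] at hx
    by_cases hyU : y ∈ U
    · exact Or.inl (hx.2 y hyU hxy)
    · refine Or.inr ?_
      rw [Finset.mem_filter, Finset.mem_compl]
      exact ⟨hyU, fun t ht hyt => hx.2 t ht (le_trans hxy hyt)⟩

omit [DistribLattice P] [DecidableLE P] in
/-- The saturation has the same trace on `U`. [this work] -/
theorem satur_inter_eq [Preorder P] [DecidableLE P] (U S : Finset P) :
    (S ∪ Uᶜ.filter fun s => ∀ t ∈ U, s ≤ t → t ∈ S) ∩ U = S ∩ U := by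
  ext x
  simp only [Finset.mem_inter, Finset.mem_union, Finset.mem_filter, Finset.mem_compl]
  constructor
  · rintro ⟨h | h, hxU⟩
    · exact ⟨h, hxU⟩
    · exact absurd hxU h.1
  · rintro ⟨h, hxU⟩; exact ⟨Or.inl h, hxU⟩

omit [DistribLattice P] [DecidableLE P] in
/-- The saturation is `U`-saturated. [this work] -/
theorem satur_saturated [Preorder P] [DecidableLE P] (U S : Finset P) :
    ∀ s ∈ Uᶜ, (∀ t ∈ U, s ≤ t → t ∈ (S ∪ Uᶜ.filter fun s => ∀ t ∈ U, s ≤ t → t ∈ S)) →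
      s ∈ (S ∪ Uᶜ.filter fun s => ∀ t ∈ U, s ≤ t → t ∈ S) := by
  intro s hs h
  rw [Finset.mem_union]
  refine Or.inr ?_
  rw [Finset.mem_filter]
  refine ⟨hs, fun t ht hst => ?_⟩
  have := h t ht hst
  rw [Finset.mem_union, Finset.mem_filter, Finset.mem_compl] at this
  rcases this with h1 | h1
  · exact h1
  · exact absurd ht h1.1

omit [DecidableLE P] in
/-- **Monotonicity of the left-hand side of PAIR in the `P∖U`-part of the first set.**  For up-sets `U, S₂, S'` and `S₁ ⊆ S₂` with the same
trace on `U`, the "need" of `(S₁, S')` is at most that of `(S₂, S')`. [this work] -/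
theorem need_mono {ν : P → ℝ} (hν₀ : 0 ≤ ν) (hν : ∀ a b, ν a * ν b ≤ ν (a ⊓ b) * ν (a ⊔ b))
    {U S₁ S₂ S' : Finset P} (hU : IsUpperSet (U : Set P)) (hS' : IsUpperSet (S' : Set P)) (h12 : S₁ ⊆ S₂)
    (htr : S₁ ∩ U = S₂ ∩ U) :
    (∑ r, ν r) * ((∑ t ∈ S₁, ν t) * (∑ t ∈ S' ∩ U, ν t) + (∑ t ∈ S', ν t) * (∑ t ∈ S₁ ∩ U, ν t))
        - (∑ r ∈ U, ν r) * (∑ t ∈ S₁, ν t) * (∑ t ∈ S', ν t) ≤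
      (∑ r, ν r) * ((∑ t ∈ S₂, ν t) * (∑ t ∈ S' ∩ U, ν t) + (∑ t ∈ S', ν t) * (∑ t ∈ S₂ ∩ U, ν t))
        - (∑ r ∈ U, ν r) * (∑ t ∈ S₂, ν t) * (∑ t ∈ S', ν t) := by
  -- split every set at `U`
  have split : ∀ X : Finset P, ∑ t ∈ X, ν t = (∑ t ∈ X ∩ U, ν t) + ∑ t ∈ X ∩ Uᶜ, ν t := fun X => by
    rw [← Finset.sum_union (Finset.disjoint_of_subset_right Finset.inter_subset_right
      (Finset.disjoint_of_subset_left Finset.inter_subset_right disjoint_compl_right))]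
    congr 1; ext x; simp only [Finset.mem_union, Finset.mem_inter, Finset.mem_compl]; tauto
  have splitZ : ∑ r, ν r = (∑ r ∈ U, ν r) + ∑ r ∈ Uᶜ, ν r := (Finset.sum_add_sum_compl U ν).symm
  have hAD := mass_U_mul_trace_compl_le hν₀ hν hU hS'
  -- the `P∖U`-mass grows from `S₁` to `S₂`
  have hD : ∑ t ∈ S₁ ∩ Uᶜ, ν t ≤ ∑ t ∈ S₂ ∩ Uᶜ, ν t :=
    Finset.sum_le_sum_of_subset_of_nonneg (Finset.inter_subset_inter_right h12) fun t _ _ => hν₀ t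
  have key : 0 ≤ ((∑ t ∈ S₂ ∩ Uᶜ, ν t) - ∑ t ∈ S₁ ∩ Uᶜ, ν t) *
      ((∑ r ∈ Uᶜ, ν r) * (∑ t ∈ S' ∩ U, ν t) - (∑ r ∈ U, ν r) * (∑ t ∈ S' ∩ Uᶜ, ν t)) :=
    mul_nonneg (sub_nonneg.2 hD) (sub_nonneg.2 hAD)
  rw [split S₁, split S₂, split S', htr, splitZ]
  nlinarith [key]

/-- **Trace reduction of the pair condition.**  Pattern `P` a finite distributive lattice, `ν ≥ 0` log-supermodular, `U` an up-set, a certificate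
`(R, F)` with exact deliveries `Σ_{t∈U} F t s = Z·N_U·ν s` (`s ∉ U`).  If PAIR holds for all pairs of `U`-SATURATED up-sets, it holds for all pairs
of up-sets. [this work] -/
theorem pair_of_saturated (U : Finset P) (hU : IsUpperSet (U : Set P)) (ν R : P → ℝ) (F : P → P → ℝ)
    (hν₀ : ∀ t, 0 ≤ ν t) (hν : ∀ a b, ν a * ν b ≤ ν (a ⊓ b) * ν (a ⊔ b))
    (hKeq : ∀ s ∈ Uᶜ, ∑ t ∈ U, F t s = (∑ r, ν r) * (∑ r ∈ U, ν r) * ν s)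
    (hsat : ∀ S S' : Finset P, IsUpperSet (S : Set P) → IsUpperSet (S' : Set P) →
      (∀ s ∈ Uᶜ, (∀ t ∈ U, s ≤ t → t ∈ S) → s ∈ S) → (∀ s ∈ Uᶜ, (∀ t ∈ U, s ≤ t → t ∈ S') → s ∈ S') →
      (∑ r, ν r) * ((∑ t ∈ S, ν t) * (∑ t ∈ S' ∩ U, ν t) + (∑ t ∈ S', ν t) * (∑ t ∈ S ∩ U, ν t))
          - (∑ r ∈ U, ν r) * (∑ t ∈ S, ν t) * (∑ t ∈ S', ν t)
        ≤ ∑ t ∈ (S ∩ S') ∩ U, R t + ∑ s ∈ (S ∩ S') ∩ Uᶜ, (∑ t ∈ U, F t s - (∑ r, ν r) * (∑ r ∈ U, ν r) * ν s)) :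
    ∀ S S' : Finset P, IsUpperSet (S : Set P) → IsUpperSet (S' : Set P) →
      (∑ r, ν r) * ((∑ t ∈ S, ν t) * (∑ t ∈ S' ∩ U, ν t) + (∑ t ∈ S', ν t) * (∑ t ∈ S ∩ U, ν t))
          - (∑ r ∈ U, ν r) * (∑ t ∈ S, ν t) * (∑ t ∈ S', ν t)
        ≤ ∑ t ∈ (S ∩ S') ∩ U, R t + ∑ s ∈ (S ∩ S') ∩ Uᶜ, (∑ t ∈ U, F t s - (∑ r, ν r) * (∑ r ∈ U, ν r) * ν s) := by
  intro S S' hS hS'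
  -- the `K`-sums vanish (exact deliveries)
  have hK0 : ∀ X : Finset P, ∑ s ∈ X ∩ Uᶜ, (∑ t ∈ U, F t s - (∑ r, ν r) * (∑ r ∈ U, ν r) * ν s) = 0 := fun X =>
    Finset.sum_eq_zero fun s hs => by rw [hKeq s (Finset.mem_of_mem_inter_right hs), sub_self]
  -- saturations
  set T := S ∪ Uᶜ.filter fun s => ∀ t ∈ U, s ≤ t → t ∈ S with hTdef
  set T' := S' ∪ Uᶜ.filter fun s => ∀ t ∈ U, s ≤ t → t ∈ S' with hT'def
  have hT : IsUpperSet (T : Set P) := isUpperSet_satur hS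
  have hT' : IsUpperSet (T' : Set P) := isUpperSet_satur hS'
  have hST : S ⊆ T := Finset.subset_union_left
  have hST' : S' ⊆ T' := Finset.subset_union_left
  have htrS : S ∩ U = T ∩ U := (satur_inter_eq U S).symm
  have htrS' : S' ∩ U = T' ∩ U := (satur_inter_eq U S').symm
  have hsatT := hsat T T' hT hT' (satur_saturated U S) (satur_saturated U S')
  -- need(S,S') ≤ need(T,S') ≤ need(T,T')
  have m1 := need_mono hν₀ hν hU hS' hST htrS
  have m2 := need_mono hν₀ hν hU hT hST' htrS'
  -- the traces of the intersections agree
  have htrace : S ∩ S' ∩ U = T ∩ T' ∩ U := by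
    have e1 : S ∩ S' ∩ U = (S ∩ U) ∩ (S' ∩ U) := by
      ext x; simp only [Finset.mem_inter]; tauto
    have e2 : T ∩ T' ∩ U = (T ∩ U) ∩ (T' ∩ U) := by
      ext x; simp only [Finset.mem_inter]; tauto
    rw [e1, e2, htrS, htrS']
  rw [hK0, add_zero, htrace]
  rw [hK0, add_zero] at hsatT
  -- symmetry of "need" in its two arguments: m1.rhs = m2.lhs and m2.rhs = hsatT.lhs
  have e1 : (∑ r, ν r) * ((∑ t ∈ T, ν t) * (∑ t ∈ S' ∩ U, ν t) + (∑ t ∈ S', ν t) * (∑ t ∈ T ∩ U, ν t))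
        - (∑ r ∈ U, ν r) * (∑ t ∈ T, ν t) * (∑ t ∈ S', ν t) =
      (∑ r, ν r) * ((∑ t ∈ S', ν t) * (∑ t ∈ T ∩ U, ν t) + (∑ t ∈ T, ν t) * (∑ t ∈ S' ∩ U, ν t))
        - (∑ r ∈ U, ν r) * (∑ t ∈ S', ν t) * (∑ t ∈ T, ν t) := by ring
  have e2 : (∑ r, ν r) * ((∑ t ∈ T', ν t) * (∑ t ∈ T ∩ U, ν t) + (∑ t ∈ T, ν t) * (∑ t ∈ T' ∩ U, ν t))
        - (∑ r ∈ U, ν r) * (∑ t ∈ T', ν t) * (∑ t ∈ T, ν t) =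
      (∑ r, ν r) * ((∑ t ∈ T, ν t) * (∑ t ∈ T' ∩ U, ν t) + (∑ t ∈ T', ν t) * (∑ t ∈ T ∩ U, ν t))
        - (∑ r ∈ U, ν r) * (∑ t ∈ T, ν t) * (∑ t ∈ T', ν t) := by ring
  linarith [m1, m2, hsatT, e1, e2]

/-- A `U`-saturated up-set is the saturation of its own trace: `S = (S ∩ U) ∪ {s ∉ U | every t ∈ U above s lies in S ∩ U}`. [this work] -/
theorem eq_satur_trace {U S : Finset P} (hS : IsUpperSet (S : Set P))
    (hsat : ∀ s ∈ Uᶜ, (∀ t ∈ U, s ≤ t → t ∈ S) → s ∈ S) :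
    S = (S ∩ U) ∪ Uᶜ.filter fun s => ∀ t ∈ U, s ≤ t → t ∈ S ∩ U := by
  ext x
  simp only [Finset.mem_union, Finset.mem_inter, Finset.mem_filter, Finset.mem_compl]
  constructor
  · intro hx
    by_cases hxU : x ∈ U
    · exact Or.inl ⟨hx, hxU⟩
    · exact Or.inr ⟨hxU, fun t ht hxt => ⟨hS hxt hx, ht⟩⟩
  · rintro (⟨hx, -⟩ | ⟨hxU, h⟩)
    · exact hx
    · exact hsat x (Finset.mem_compl.2 hxU) fun t ht hxt => (h t ht hxt).1

/-- **Trace form of the reduction.**  Under the hypotheses of `pair_of_saturated`, PAIR for all pairs of up-sets follows from PAIR on the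
pairs `(Ŝ(X), Ŝ(X'))`, `Ŝ(X) = X ∪ {s ∉ U | every t ∈ U above s lies in X}`, for up-sets `X, X' ⊆ U` (the possible traces).  For a small
pattern this is a short explicit list (maj on `2³`: 9 traces). [this work] -/
theorem pair_of_traces (U : Finset P) (hU : IsUpperSet (U : Set P)) (ν R : P → ℝ) (F : P → P → ℝ)
    (hν₀ : ∀ t, 0 ≤ ν t) (hν : ∀ a b, ν a * ν b ≤ ν (a ⊓ b) * ν (a ⊔ b))
    (hKeq : ∀ s ∈ Uᶜ, ∑ t ∈ U, F t s = (∑ r, ν r) * (∑ r ∈ U, ν r) * ν s)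
    (htr : ∀ X X' : Finset P, X ⊆ U → X' ⊆ U → IsUpperSet (X : Set P) → IsUpperSet (X' : Set P) →
      (∑ r, ν r) * ((∑ t ∈ (X ∪ Uᶜ.filter fun s => ∀ t ∈ U, s ≤ t → t ∈ X), ν t) *
            (∑ t ∈ (X' ∪ Uᶜ.filter fun s => ∀ t ∈ U, s ≤ t → t ∈ X') ∩ U, ν t)
          + (∑ t ∈ (X' ∪ Uᶜ.filter fun s => ∀ t ∈ U, s ≤ t → t ∈ X'), ν t) *
            (∑ t ∈ (X ∪ Uᶜ.filter fun s => ∀ t ∈ U, s ≤ t → t ∈ X) ∩ U, ν t))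
          - (∑ r ∈ U, ν r) * (∑ t ∈ (X ∪ Uᶜ.filter fun s => ∀ t ∈ U, s ≤ t → t ∈ X), ν t) *
            (∑ t ∈ (X' ∪ Uᶜ.filter fun s => ∀ t ∈ U, s ≤ t → t ∈ X'), ν t)
        ≤ ∑ t ∈ ((X ∪ Uᶜ.filter fun s => ∀ t ∈ U, s ≤ t → t ∈ X) ∩ (X' ∪ Uᶜ.filter fun s => ∀ t ∈ U, s ≤ t → t ∈ X')) ∩ U, R t
          + ∑ s ∈ ((X ∪ Uᶜ.filter fun s => ∀ t ∈ U, s ≤ t → t ∈ X) ∩ (X' ∪ Uᶜ.filter fun s => ∀ t ∈ U, s ≤ t → t ∈ X')) ∩ Uᶜ,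
              (∑ t ∈ U, F t s - (∑ r, ν r) * (∑ r ∈ U, ν r) * ν s)) :
    ∀ S S' : Finset P, IsUpperSet (S : Set P) → IsUpperSet (S' : Set P) →
      (∑ r, ν r) * ((∑ t ∈ S, ν t) * (∑ t ∈ S' ∩ U, ν t) + (∑ t ∈ S', ν t) * (∑ t ∈ S ∩ U, ν t))
          - (∑ r ∈ U, ν r) * (∑ t ∈ S, ν t) * (∑ t ∈ S', ν t)
        ≤ ∑ t ∈ (S ∩ S') ∩ U, R t + ∑ s ∈ (S ∩ S') ∩ Uᶜ, (∑ t ∈ U, F t s - (∑ r, ν r) * (∑ r ∈ U, ν r) * ν s) := by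
  refine pair_of_saturated U hU ν R F hν₀ hν hKeq fun S S' hS hS' hSs hS's => ?_
  have hXU : IsUpperSet ((S ∩ U : Finset P) : Set P) := by rw [Finset.coe_inter]; exact hS.inter hU
  have hX'U : IsUpperSet ((S' ∩ U : Finset P) : Set P) := by rw [Finset.coe_inter]; exact hS'.inter hU
  have key := htr (S ∩ U) (S' ∩ U) Finset.inter_subset_right Finset.inter_subset_right hXU hX'U
  rw [← eq_satur_trace hS hSs, ← eq_satur_trace hS' hS's] at key
  exact key

end Summit.CriticalPhenomena.PercolationContinuityZ3.Theorems.SahiE3PatternReduction
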